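import Summits.Ventures.CertifiedManyBodySolver.Downfold.EmeryFermiEnergyExistsAll
import HarnessLib

/-!
# THE SUB-QUADRATIC `t_pd` LAW: `ε_AB(μ·t_pd) ≤ μ²·ε_AB(t_pd)` pointwise on the zone and `ε_F(μ·t_pd; ν) ≤ μ²·ε_F(t_pd; ν)` at every filling —
# the antibonding band and the Fermi energy, measured in units of `t_pd²`, DECREASE with the hybridisation (an exact polynomial identity with
# non-negative coefficients; no certificate, no calculus)

Venture CertifiedManyBodySolver, cell `pub/hubbard-downfold` (stage S1; INFLATION-RULES-3to1-B §B.85 (a)–(d)), seat hubbard-downfold-mod-4 (technique B = band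
level, g35); namespace `Summit.Ventures.CertifiedManyBodySolver.Downfold.Emery`. Everything PROVED (0 sorry, no definition). WHAT THIS IS NOT: a statement
about any material; `U = 0` one-body kinematics of the σ (d–p_x–p_y + t_pp, t_pp′) model; no number lives here.

`EmeryHoppingLevers` (§B.83 (h)) signed the `t_pd` direction of the band and of the Fermi energy: both are non-decreasing in `t_pd²` (the secular cubic is
affine non-increasing in `t_pd²`). This file bounds the same direction FROM ABOVE, which is what the `t_pd` lever of the fixed-doping Fermi-surface SHAPE
needs (§B.85 (e), `EmeryHybridisationShapeLever`): in units of `t_pd²` the band goes DOWN.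

* §1 THE IDENTITY. Write the secular cubic as `charCubic(t_pd; t) = t·Q(t) − t_pd²·L(t)` with `Q(t) = (Δ + 4t_pp′x + t)(Δ + 4t_pp′y + t) − 16t_pp²xy` and
  `L(t) = 4x(Δ + 4t_pp′y + t) + 4y(Δ + 4t_pp′x + t) + 32t_pp·xy ≥ 0` (`charCubic_tpd_affine`). Then for all `m`, `E` (`charCubic_subquadratic_identity`, `ring`):
  `L(E)·charCubic(t_pd′; mE) − m·L(mE)·charCubic(t_pd; E) = m(m − 1)E²·W(mE, E) + (m·t_pd² − t_pd′²)·L(E)·L(mE)`, where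
  **`W(T, E) = 4(x + y)(T + Δ)(E + Δ) + 32xy(t_pp + t_pp′)(T + E + 2Δ + 2(t_pp + t_pp′)(x + y))` has NON-NEGATIVE COEFFICIENTS** — it is the quotient
  `[Q(T)L(E) − Q(E)L(T)]/(T − E)`, i.e. `Q/L` restricted to the band is super-linear.
* §2 THE BAND (`abBand_tpd_le_sq_mul`): for `μ ≥ 1`, `Δ > 0`, `t_pp, t_pp′, x, y ≥ 0`: **`ε_AB(Δ, μt_pd, t_pp, t_pp′; x, y) ≤ μ²·ε_AB(Δ, t_pd, t_pp, t_pp′; x, y)`**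
  (read the identity at `t_pd′ = μt_pd`, `m = μ²`, `E = ε_AB(t_pd)`: the scaled cubic is `≥ 0` at `μ²E > 0`, so `μ²E` is not below its top root). With
  `abBand_mono_tpdSq`: `ε_AB(t_pd) ≤ ε_AB(μt_pd) ≤ μ²ε_AB(t_pd)` (`abBand_tpd_mem_Icc`).
* §3 THE FILLING (`abFilling_le_abFilling_tpd_sq`): `abFilling(t_pd; ε) ≤ abFilling(μt_pd; μ²ε)` (occupied-set inclusion).
* §4 THE FERMI ENERGY (`fermiEnergyOf_tpd_le_sq_mul`, certificate-free `…'`): **`ε_F(Δ, μt_pd, t_pp, t_pp′; ν) ≤ μ²·ε_F(Δ, t_pd, t_pp, t_pp′; ν)`** for every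
  `0 < ν < 1`; bracket form `ε_F(t_pd) ≤ ε_F(μt_pd) ≤ μ²ε_F(t_pd)` (`fermiEnergyOf_tpd_mem_Icc`); ratio form **`ε_F(t_pd′)/t_pd′² ≤ ε_F(t_pd)/t_pd²` for
  `0 < t_pd ≤ t_pd′`** (`fermiEnergyOf_div_sq_anti`) — THE FERMI ENERGY PER `t_pd²` IS NON-INCREASING IN `t_pd` (bandwidth `∝ t_pd²/Δ` at weak
  hybridisation, `∝ t_pd` at strong: the law interpolates with no regime hypothesis).

Sources: three-band model [HybertsenSchluterChristensen1989, Eq. (1)]; contour variables [AndersenEtAl1995, §6]; polynomial algebra [folklore].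
-/

noncomputable section

namespace Summit.Ventures.CertifiedManyBodySolver.Downfold.Emery

open Real MeasureTheory Set

/-! ## §1 The identity -/

/-- The secular cubic is affine in `t_pd²`: `charCubic = t·Q(t) − t_pd²·L(t)` with `Q(t) = (Δ + 4cx + t)(Δ + 4cy + t) − 16b²xy`,
`L(t) = 4x(Δ + 4cy + t) + 4y(Δ + 4cx + t) + 32bxy`. [folklore] -/
theorem charCubic_tpd_affine (Δ a b c x y t : ℝ) :
    charCubic Δ a b c x y t =
      t * ((Δ + 4 * c * x + t) * (Δ + 4 * c * y + t) - 16 * b ^ 2 * x * y)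
        - a ^ 2 * (4 * x * (Δ + 4 * c * y + t) + 4 * y * (Δ + 4 * c * x + t) + 32 * b * x * y) := by
  unfold charCubic; ring

/-- `L(t) ≥ 0` for `Δ, c, b, x, y ≥ 0`, `t ≥ 0`. [folklore] -/
theorem tpdSlope_nonneg {Δ b c x y t : ℝ} (hΔ : 0 ≤ Δ) (hc : 0 ≤ c) (hb : 0 ≤ b) (hx : 0 ≤ x) (hy : 0 ≤ y) (ht : 0 ≤ t) :
    0 ≤ 4 * x * (Δ + 4 * c * y + t) + 4 * y * (Δ + 4 * c * x + t) + 32 * b * x * y := by positivity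

/-- `L(t) > 0` off Γ (`x + y > 0`) for `Δ > 0`, `c, b, x, y, t ≥ 0`. [folklore] -/
theorem tpdSlope_pos {Δ b c x y t : ℝ} (hΔ : 0 < Δ) (hc : 0 ≤ c) (hb : 0 ≤ b) (hx : 0 ≤ x) (hy : 0 ≤ y) (hxy : 0 < x + y) (ht : 0 ≤ t) :
    0 < 4 * x * (Δ + 4 * c * y + t) + 4 * y * (Δ + 4 * c * x + t) + 32 * b * x * y := by
  have h1 : 0 ≤ 4 * x * (4 * c * y + t) + 4 * y * (4 * c * x + t) + 32 * b * x * y := by positivity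
  have h2 : 0 < 4 * (x + y) * Δ := by positivity
  nlinarith

/-- **THE SUB-QUADRATIC IDENTITY** (pure `ring`): with `L` as in `charCubic_tpd_affine` and
`W(T, E) = 4(x + y)(T + Δ)(E + Δ) + 32xy(b + c)(T + E + 2Δ + 2(b + c)(x + y))`,
`L(E)·charCubic(a′; mE) − m·L(mE)·charCubic(a; E) = m(m − 1)E²·W(mE, E) + (m·a² − a′²)·L(E)·L(mE)`. [folklore] -/
theorem charCubic_subquadratic_identity (Δ a a' b c x y E m : ℝ) :
    (4 * x * (Δ + 4 * c * y + E) + 4 * y * (Δ + 4 * c * x + E) + 32 * b * x * y) * charCubic Δ a' b c x y (m * E)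
      - m * (4 * x * (Δ + 4 * c * y + m * E) + 4 * y * (Δ + 4 * c * x + m * E) + 32 * b * x * y) * charCubic Δ a b c x y E =
      m * (m - 1) * E ^ 2 *
          (4 * (x + y) * (m * E + Δ) * (E + Δ) + 32 * x * y * (b + c) * (m * E + E + 2 * Δ + 2 * (b + c) * (x + y)))
        + (m * a ^ 2 - a' ^ 2) * (4 * x * (Δ + 4 * c * y + E) + 4 * y * (Δ + 4 * c * x + E) + 32 * b * x * y)
          * (4 * x * (Δ + 4 * c * y + m * E) + 4 * y * (Δ + 4 * c * x + m * E) + 32 * b * x * y) := by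
  unfold charCubic; ring

/-- The quotient `W(T, E)` is non-negative for `Δ, b, c, x, y ≥ 0`, `T, E ≥ −Δ`… here in the form used: `Δ, b, c, x, y, T, E ≥ 0`. [folklore] -/
theorem subquadW_nonneg {Δ b c x y T E : ℝ} (hΔ : 0 ≤ Δ) (hc : 0 ≤ c) (hb : 0 ≤ b) (hx : 0 ≤ x) (hy : 0 ≤ y) (hT : 0 ≤ T) (hE : 0 ≤ E) :
    0 ≤ 4 * (x + y) * (T + Δ) * (E + Δ) + 32 * x * y * (b + c) * (T + E + 2 * Δ + 2 * (b + c) * (x + y)) := by positivity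

/-- `a² ≤ (μa)²` for `μ ≥ 1`. [folklore] -/
theorem sq_le_sq_mul_of_one_le {μ : ℝ} (hμ : 1 ≤ μ) (a : ℝ) : a ^ 2 ≤ (μ * a) ^ 2 := by
  have hμ2 : 1 ≤ μ ^ 2 := by nlinarith
  rw [mul_pow]
  calc a ^ 2 = 1 * a ^ 2 := by ring
    _ ≤ μ ^ 2 * a ^ 2 := mul_le_mul_of_nonneg_right hμ2 (sq_nonneg a)

/-! ## §2 The band -/

section Band

variable {Δ a b c x y μ : ℝ}

/-- **`ε_AB(Δ, μt_pd, t_pp, t_pp′; x, y) ≤ μ²·ε_AB(Δ, t_pd, t_pp, t_pp′; x, y)`** for `μ ≥ 1` (`Δ > 0`; `t_pp, t_pp′, x, y ≥ 0`). [folklore] -/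
theorem abBand_tpd_le_sq_mul (hΔ : 0 < Δ) (hc : 0 ≤ c) (hb : 0 ≤ b) (hx : 0 ≤ x) (hy : 0 ≤ y) (hμ : 1 ≤ μ) :
    abBand Δ (μ * a) b c x y ≤ μ ^ 2 * abBand Δ a b c x y := by
  have hμ2 : 1 ≤ μ ^ 2 := by nlinarith
  by_cases hxy : 0 < x + y
  · by_cases ha : a = 0
    · -- no hybridisation: both rows coincide
      rw [ha, mul_zero]
      have h0 := abBand_nonneg (tpd := (0 : ℝ)) hΔ.le hc hb hx hy
      nlinarith
    · set E := abBand Δ a b c x y with hE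
      have hEpos : 0 < E := abBand_pos_of_sum_pos hΔ ha hc hb hx hy hxy
      have hT : 0 < μ ^ 2 * E := by positivity
      -- the scaled cubic is ≥ 0 at μ²E
      have hL : 0 < 4 * x * (Δ + 4 * c * y + E) + 4 * y * (Δ + 4 * c * x + E) + 32 * b * x * y :=
        tpdSlope_pos hΔ hc hb hx hy hxy hEpos.le
      have hid := charCubic_subquadratic_identity Δ a (μ * a) b c x y E (μ ^ 2)
      rw [charCubic_abBand, mul_zero, sub_zero, show μ ^ 2 * a ^ 2 - (μ * a) ^ 2 = 0 by ring, zero_mul, zero_mul, add_zero] at hid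
      have hW := subquadW_nonneg (T := μ ^ 2 * E) hΔ.le hc hb hx hy hT.le hEpos.le
      have hval : 0 ≤ charCubic Δ (μ * a) b c x y (μ ^ 2 * E) := by
        have hprod : 0 ≤ (4 * x * (Δ + 4 * c * y + E) + 4 * y * (Δ + 4 * c * x + E) + 32 * b * x * y) *
            charCubic Δ (μ * a) b c x y (μ ^ 2 * E) := by
          rw [hid]
          have : 0 ≤ μ ^ 2 * (μ ^ 2 - 1) * E ^ 2 := by
            have : 0 ≤ μ ^ 2 - 1 := by linarith
            positivity
          exact mul_nonneg this hW
        by_contra hneg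
        push Not at hneg
        have := mul_neg_of_pos_of_neg hL hneg
        linarith
      by_contra hlt
      push Not at hlt
      have := charCubic_neg_of_pos_of_lt_abBand hΔ.le hc hb hx hy hT hlt
      linarith
  · have hx0 : x = 0 := by linarith
    have hy0 : y = 0 := by linarith
    rw [hx0, hy0, abBand_Gamma hΔ.le, abBand_Gamma hΔ.le, mul_zero]

/-- The two `t_pd` bounds as one bracket: `ε_AB(t_pd) ≤ ε_AB(μt_pd) ≤ μ²·ε_AB(t_pd)` (`μ ≥ 1`). [folklore] -/
theorem abBand_tpd_mem_Icc (hΔ : 0 < Δ) (hc : 0 ≤ c) (hb : 0 ≤ b) (hx : 0 ≤ x) (hy : 0 ≤ y) (hμ : 1 ≤ μ) :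
    abBand Δ (μ * a) b c x y ∈ Icc (abBand Δ a b c x y) (μ ^ 2 * abBand Δ a b c x y) :=
  ⟨abBand_mono_tpdSq hΔ.le hc hb hx hy (sq_le_sq_mul_of_one_le hμ a),
    abBand_tpd_le_sq_mul hΔ hc hb hx hy hμ⟩

end Band

/-! ## §3 The filling -/

section Filling

variable {Δ a b c μ : ℝ}

/-- `abFilling(t_pd; ε) ≤ abFilling(μt_pd; μ²ε)` (`μ ≥ 1`): every state occupied at `ε` in the row `t_pd` is occupied at `μ²ε` in the row `μt_pd`. [folklore] -/
theorem abFilling_le_abFilling_tpd_sq (hΔ : 0 < Δ) (hc : 0 ≤ c) (hb : 0 ≤ b) (hμ : 1 ≤ μ) (ε : ℝ) :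
    abFilling Δ a b c ε ≤ abFilling Δ (μ * a) b c (μ ^ 2 * ε) := by
  unfold abFilling
  refine div_le_div_of_nonneg_right ?_ (by positivity)
  refine ENNReal.toReal_mono (volume_abOccSet_ne_top _ _ _ _ _) (measure_mono ?_)
  intro k hk
  refine ⟨hk.1, ?_⟩
  have h1 := abBand_tpd_le_sq_mul (a := a) hΔ hc hb (halfSq_nonneg k.1) (halfSq_nonneg k.2) hμ
  have h2 : abBand Δ a b c (halfSq k.1) (halfSq k.2) ≤ ε := hk.2
  show abBand Δ (μ * a) b c (halfSq k.1) (halfSq k.2) ≤ μ ^ 2 * ε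
  nlinarith [sq_nonneg μ]

end Filling

/-! ## §4 The Fermi energy -/

section Fermi

variable {Δ a b c μ ν : ℝ}

/-- **`ε_F(Δ, μt_pd, t_pp, t_pp′; ν) ≤ μ²·ε_F(Δ, t_pd, t_pp, t_pp′; ν)`** for `μ ≥ 1` and `0 < ν < 1` attained at both rows. [folklore] -/
theorem fermiEnergyOf_tpd_le_sq_mul (hΔ : 0 < Δ) (hc : 0 ≤ c) (hb : 0 ≤ b) (hμ : 1 ≤ μ) (hν0 : 0 < ν) (hν1 : ν < 1)
    (hex : ∃ ε : ℝ, abFilling Δ a b c ε = ν) (hex' : ∃ ε : ℝ, abFilling Δ (μ * a) b c ε = ν) :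
    fermiEnergyOf Δ (μ * a) b c ν ≤ μ ^ 2 * fermiEnergyOf Δ a b c ν := by
  have h : abFilling Δ a b c (fermiEnergyOf Δ a b c ν) = ν := abFilling_fermiEnergyOf hΔ.le hc hb hν0 hν1 hex
  have h' : abFilling Δ (μ * a) b c (fermiEnergyOf Δ (μ * a) b c ν) = ν := abFilling_fermiEnergyOf hΔ.le hc hb hν0 hν1 hex'
  by_contra hlt
  push Not at hlt
  obtain ⟨k, hk, hkE⟩ := exists_gt_of_abFilling_lt_one (Δ := Δ) (a := μ * a) (b := b) (c := c)
    (ε := fermiEnergyOf Δ (μ * a) b c ν) (by rw [h']; exact hν1)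
  have h0 : 0 ≤ μ ^ 2 * fermiEnergyOf Δ a b c ν :=
    mul_nonneg (sq_nonneg μ) (fermiEnergyOf_nonneg hΔ.le hc hb hν0 hν1 hex)
  have hstrict := abFilling_lt_abFilling (a := μ * a) hΔ.le hc hb h0 hlt hk hkE.le
  have htr := abFilling_le_abFilling_tpd_sq (a := a) hΔ hc hb hμ (fermiEnergyOf Δ a b c ν)
  linarith

/-- Certificate-free form (`Δ > 0`, `t_pd ≠ 0`): `ε_F(μt_pd; ν) ≤ μ²·ε_F(t_pd; ν)`. [folklore] -/
theorem fermiEnergyOf_tpd_le_sq_mul' (hΔ : 0 < Δ) (ha : a ≠ 0) (hc : 0 ≤ c) (hb : 0 ≤ b) (hμ : 1 ≤ μ) (hν0 : 0 < ν) (hν1 : ν < 1) :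
    fermiEnergyOf Δ (μ * a) b c ν ≤ μ ^ 2 * fermiEnergyOf Δ a b c ν := by
  have hμa : μ * a ≠ 0 := mul_ne_zero (by linarith) ha
  obtain ⟨ε, -, hε⟩ := exists_fermiEnergy_of_mem_Ioo hΔ ha hc hb hν0 hν1
  obtain ⟨ε', -, hε'⟩ := exists_fermiEnergy_of_mem_Ioo hΔ hμa hc hb hν0 hν1
  exact fermiEnergyOf_tpd_le_sq_mul hΔ hc hb hμ hν0 hν1 ⟨ε, hε⟩ ⟨ε', hε'⟩

/-- **THE `t_pd` BRACKET OF THE FERMI ENERGY**: `ε_F(t_pd) ≤ ε_F(μt_pd) ≤ μ²·ε_F(t_pd)` (`μ ≥ 1`; `Δ > 0`, `t_pd ≠ 0`; certificate-free). [folklore] -/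
theorem fermiEnergyOf_tpd_mem_Icc (hΔ : 0 < Δ) (ha : a ≠ 0) (hc : 0 ≤ c) (hb : 0 ≤ b) (hμ : 1 ≤ μ) (hν0 : 0 < ν) (hν1 : ν < 1) :
    fermiEnergyOf Δ (μ * a) b c ν ∈ Icc (fermiEnergyOf Δ a b c ν) (μ ^ 2 * fermiEnergyOf Δ a b c ν) := by
  have hμa : μ * a ≠ 0 := mul_ne_zero (by linarith) ha
  obtain ⟨ε, -, hε⟩ := exists_fermiEnergy_of_mem_Ioo hΔ ha hc hb hν0 hν1
  obtain ⟨ε', -, hε'⟩ := exists_fermiEnergy_of_mem_Ioo hΔ hμa hc hb hν0 hν1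
  exact ⟨fermiEnergyOf_mono_tpdSq hΔ.le hc hb (sq_le_sq_mul_of_one_le hμ a) hν0 hν1 ⟨ε, hε⟩ ⟨ε', hε'⟩,
    fermiEnergyOf_tpd_le_sq_mul hΔ hc hb hμ hν0 hν1 ⟨ε, hε⟩ ⟨ε', hε'⟩⟩

/-- **THE FERMI ENERGY PER `t_pd²` IS NON-INCREASING IN `t_pd`**: for `0 < t_pd ≤ t_pd′`, `ε_F(t_pd′)/t_pd′² ≤ ε_F(t_pd)/t_pd²` (certificate-free).
[folklore] -/
theorem fermiEnergyOf_div_sq_anti {a' : ℝ} (hΔ : 0 < Δ) (ha : 0 < a) (haa : a ≤ a') (hc : 0 ≤ c) (hb : 0 ≤ b) (hν0 : 0 < ν) (hν1 : ν < 1) :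
    fermiEnergyOf Δ a' b c ν / a' ^ 2 ≤ fermiEnergyOf Δ a b c ν / a ^ 2 := by
  have ha' : 0 < a' := lt_of_lt_of_le ha haa
  have hμ : 1 ≤ a' / a := by rw [le_div_iff₀ ha]; linarith
  have h := fermiEnergyOf_tpd_le_sq_mul' (μ := a' / a) hΔ ha.ne' hc hb hμ hν0 hν1
  rw [div_mul_cancel₀ _ ha.ne'] at h
  rw [div_le_div_iff₀ (by positivity) (by positivity)]
  calc fermiEnergyOf Δ a' b c ν * a ^ 2 ≤ (a' / a) ^ 2 * fermiEnergyOf Δ a b c ν * a ^ 2 :=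
        mul_le_mul_of_nonneg_right h (sq_nonneg a)
    _ = fermiEnergyOf Δ a b c ν * a' ^ 2 := by field_simp

end Fermi

end Summit.Ventures.CertifiedManyBodySolver.Downfold.Emery
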